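import Mathlib

/-!
# Block-Toeplitz slot configurations I: block syzygies are orthogonal to the targets

Support file for crux item `stmt-MatrixMultiplication-10752`
(`Summit.MatrixMultiplication.MatrixMultiplication.Theses.HiddenToeplitzCorners.HiddenCornerLemmaR`),
line `atkinson-lloyd-core-split`, stub `stub_mixedDeepBound` (mixed compression classes), first
half of the **block-Toeplitz slot lemma** `hclR_blockToeplitz_slot`
(`HiddenCornerLemmaRBlockToeplitzSlot`), which generalises the honest Toeplitz three-slot lemma
`hclR_toeplitz_three_slot` from one column block to `B` column blocks and `B + 2` slots.

Setting.  `blk : Fin N → Fin B` labels the columns; `T` is *block-Toeplitz* if `T i j = T i' j'`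
whenever `blk j = blk j'` and `i + j' = i' + j`; every block lies below its offset,
`m < o (blk m)`.  The frame vector `E c` has the shifted reversed block polynomials
`Ẽ_c^v = ∑_{blk m = v} E c m · X^(o v - 1 - m)`, and a *simultaneous syzygy* is a tuple `P` with
`∑_c P_c Ẽ_c^v = 0` for every block `v`.

* `hclR_blk_pair_eq_zero` — if the coefficient vectors `Λ c` form a simultaneous syzygy then
  `∑_c ⟪Λ c, T E_c⟫ = 0` for every block-Toeplitz `T` (inside block `v` the entry `T n m` only
  depends on the lag `n + (o v - 1 - m)`, and the lag-`k` sum of `∑_c Λ c n · E c m` is the `k`-th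
  coefficient of the block-`v` syzygy).
* `hclR_blk_orth` — step (A) of the slot lemma: in a slot configuration `T b *ᵥ E c = [b = c] • f`,
  a simultaneous syzygy of degree `≤ μ` makes the coefficients of `P_b · φ` vanish in degrees
  `[μ, N)` (`φ` the reversed target polynomial).
Pure polynomial algebra over `ℂ[X]`; nothing beyond Mathlib.
-/

set_option linter.dupNamespace false

namespace Summit.MatrixMultiplication.MatrixMultiplication.Theorems

open Polynomial Matrix BigOperators Finset

/-- Coefficients of the product of a coefficient polynomial `∑ C (a n) X^n` with a shifted,
reversed block polynomial `∑_{m ∈ block v} C (b m) X^(o - 1 - m)`. -/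
theorem hclR_blk_coeff_mul_rev {N B : ℕ} (blk : Fin N → Fin B) (v : Fin B) (o : ℕ)
    (a b : Fin N → ℂ) (k : ℕ) :
    ((∑ n : Fin N, C (a n) * X ^ (n : ℕ)) *
        (∑ m : Fin N, if blk m = v then C (b m) * X ^ (o - 1 - m) else 0)).coeff k =
      ∑ n : Fin N, ∑ m : Fin N,
        if blk m = v ∧ k = (n : ℕ) + (o - 1 - m) then a n * b m else 0 := by
  rw [Finset.sum_mul_sum, finsetSum_coeff]
  refine Finset.sum_congr rfl fun n _ => ?_
  rw [finsetSum_coeff]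
  refine Finset.sum_congr rfl fun m _ => ?_
  by_cases hm : blk m = v
  · rw [if_pos hm]
    have : C (a n) * X ^ (n : ℕ) * (C (b m) * X ^ (o - 1 - (m : ℕ))) =
        C (a n * b m) * X ^ ((n : ℕ) + (o - 1 - m)) := by
      rw [C_mul, pow_add]; ring
    rw [this, coeff_C_mul_X_pow]
    by_cases hk : k = (n : ℕ) + (o - 1 - m)
    · rw [if_pos hk, if_pos ⟨hm, hk⟩]
    · rw [if_neg hk, if_neg (fun h => hk h.2)]
  · rw [if_neg hm, mul_zero, coeff_zero, if_neg (fun h => hm h.1)]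

/-- **Block syzygies are orthogonal to block-Toeplitz images.**  If `T i j` depends only on
`i - j` as long as `j` stays in one block of `blk` (every block lying below its offset `o`), and
the coefficient vectors `Λ c` form a simultaneous syzygy of the shifted reversed block polynomials
of the frame, then `∑_c ⟪Λ c, T E_c⟫ = 0`. -/
theorem hclR_blk_pair_eq_zero {N B : ℕ} (blk : Fin N → Fin B) (o : Fin B → ℕ)
    (ho : ∀ m : Fin N, (m : ℕ) < o (blk m))
    (T : Matrix (Fin N) (Fin N) ℂ)
    (hT : ∀ i j i' j' : Fin N, blk j = blk j' → (i : ℕ) + j' = i' + j → T i j = T i' j')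
    {ι : Type*} [Fintype ι] (Λ E : ι → Fin N → ℂ)
    (hsyz : ∀ v : Fin B, ∑ c, (∑ n : Fin N, C (Λ c n) * X ^ (n : ℕ)) *
      (∑ m : Fin N, if blk m = v then C (E c m) * X ^ (o v - 1 - m) else 0) = 0) :
    ∑ c, Λ c ⬝ᵥ (T *ᵥ E c) = 0 := by
  -- coefficient `k` of the block-`v` syzygy
  have hk : ∀ (v : Fin B) (k : ℕ), ∑ n : Fin N, ∑ m : Fin N,
      (if blk m = v ∧ k = (n : ℕ) + (o v - 1 - m) then ∑ c, Λ c n * E c m else 0) = 0 := by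
    intro v k
    have h : (∑ c, (∑ n : Fin N, C (Λ c n) * X ^ (n : ℕ)) *
        (∑ m : Fin N, if blk m = v then C (E c m) * X ^ (o v - 1 - m) else 0)).coeff k = 0 := by
      rw [hsyz v, coeff_zero]
    rw [finsetSum_coeff] at h
    simp_rw [hclR_blk_coeff_mul_rev] at h
    rw [Finset.sum_comm] at h
    have e : ∀ n m : Fin N,
        (if blk m = v ∧ k = (n : ℕ) + (o v - 1 - m) then ∑ c, Λ c n * E c m else 0)
        = ∑ c, (if blk m = v ∧ k = (n : ℕ) + (o v - 1 - m) then Λ c n * E c m else 0) := by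
      intro n m; split_ifs <;> simp
    calc (∑ n : Fin N, ∑ m : Fin N,
          if blk m = v ∧ k = (n : ℕ) + (o v - 1 - m) then ∑ c, Λ c n * E c m else 0)
        = ∑ n : Fin N, ∑ c, ∑ m : Fin N,
            (if blk m = v ∧ k = (n : ℕ) + (o v - 1 - m) then Λ c n * E c m else 0) := by
          refine Finset.sum_congr rfl fun n _ => ?_
          rw [Finset.sum_congr rfl fun m _ => e n m]
          exact Finset.sum_comm
      _ = 0 := h
  -- rewrite the pairing as a double sum against `T`
  have e1 : ∑ c, Λ c ⬝ᵥ (T *ᵥ E c) = ∑ n : Fin N, ∑ m : Fin N, T n m * ∑ c, Λ c n * E c m := by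
    simp only [dotProduct, Matrix.mulVec, Finset.mul_sum]
    rw [Finset.sum_comm]
    refine Finset.sum_congr rfl fun n _ => ?_
    rw [Finset.sum_comm]
    refine Finset.sum_congr rfl fun m _ => Finset.sum_congr rfl fun c _ => ?_
    ring
  rw [e1]
  -- insert the block index `v = blk m`
  have e0 : ∀ n m : Fin N, T n m * ∑ c, Λ c n * E c m =
      ∑ v : Fin B, if blk m = v then T n m * ∑ c, Λ c n * E c m else 0 := by
    intro n m
    rw [Finset.sum_ite_eq, if_pos (Finset.mem_univ _)]
  rw [Finset.sum_congr rfl fun n _ => Finset.sum_congr rfl fun m _ => e0 n m]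
  rw [Finset.sum_comm]
  conv_lhs => arg 2; ext m; rw [Finset.sum_comm]
  rw [Finset.sum_comm]
  refine Finset.sum_eq_zero fun v _ => ?_
  -- fix the block `v`; insert the lag index `k = n + (o v - 1 - m) < N + o v`
  set M := N + o v with hM
  have e2 : ∀ n m : Fin N, (if blk m = v then T n m * ∑ c, Λ c n * E c m else 0) =
      ∑ k ∈ Finset.range M,
        if blk m = v ∧ k = (n : ℕ) + (o v - 1 - m) then T n m * ∑ c, Λ c n * E c m else 0 := by
    intro n m
    by_cases hm : blk m = v
    · rw [if_pos hm]
      have e3 : ∀ k, (if blk m = v ∧ k = (n : ℕ) + (o v - 1 - m) then T n m * ∑ c, Λ c n * E c m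
          else 0) = (if k = (n : ℕ) + (o v - 1 - m) then T n m * ∑ c, Λ c n * E c m else 0) := by
        intro k
        by_cases hk : k = (n : ℕ) + (o v - 1 - m)
        · rw [if_pos ⟨hm, hk⟩, if_pos hk]
        · rw [if_neg (fun h => hk h.2), if_neg hk]
      rw [Finset.sum_congr rfl fun k _ => e3 k, Finset.sum_ite_eq']
      have : (n : ℕ) + (o v - 1 - m) ∈ Finset.range M := by
        rw [Finset.mem_range]; have := n.is_lt; omega
      rw [if_pos this]
    · rw [if_neg hm]
      exact (Finset.sum_eq_zero fun k _ => by rw [if_neg (fun h => hm h.1)]).symm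
  rw [Finset.sum_congr rfl fun m _ => Finset.sum_congr rfl fun n _ => e2 n m]
  rw [Finset.sum_comm]
  conv_lhs => arg 2; ext n; rw [Finset.sum_comm]
  rw [Finset.sum_comm]
  refine Finset.sum_eq_zero fun k _ => ?_
  -- on the fiber of `(v, k)`, `T` is constant
  by_cases hex : ∃ n₀ m₀ : Fin N, blk m₀ = v ∧ k = (n₀ : ℕ) + (o v - 1 - m₀)
  · obtain ⟨n₀, m₀, hm₀, h₀⟩ := hex
    have hc : ∀ n m : Fin N, blk m = v ∧ k = (n : ℕ) + (o v - 1 - m) → T n m = T n₀ m₀ := by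
      intro n m h
      apply hT n m n₀ m₀ (h.1.trans hm₀.symm)
      have h1 := ho m; have h2 := ho m₀
      rw [h.1] at h1; rw [hm₀] at h2
      omega
    calc (∑ n : Fin N, ∑ m : Fin N,
          if blk m = v ∧ k = (n : ℕ) + (o v - 1 - m) then T n m * ∑ c, Λ c n * E c m else 0)
        = ∑ n : Fin N, ∑ m : Fin N,
          T n₀ m₀ * (if blk m = v ∧ k = (n : ℕ) + (o v - 1 - m) then ∑ c, Λ c n * E c m
            else 0) := by
          refine Finset.sum_congr rfl fun n _ => Finset.sum_congr rfl fun m _ => ?_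
          split_ifs with h
          · rw [hc n m h]
          · rw [mul_zero]
      _ = T n₀ m₀ * ∑ n : Fin N, ∑ m : Fin N,
          (if blk m = v ∧ k = (n : ℕ) + (o v - 1 - m) then ∑ c, Λ c n * E c m else 0) := by
          rw [Finset.mul_sum]
          refine Finset.sum_congr rfl fun n _ => ?_
          rw [Finset.mul_sum]
      _ = 0 := by rw [hk v k, mul_zero]
  · push Not at hex
    refine Finset.sum_eq_zero fun n _ => Finset.sum_eq_zero fun m _ => ?_
    rw [if_neg]
    rintro ⟨h1, h2⟩
    exact hex n m h1 h2

/-- A polynomial of degree `< N` is the coefficient polynomial of its coefficient vector. -/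
theorem hclR_blk_sum_C_coeff {N : ℕ} (p : ℂ[X]) (hp : p.natDegree < N) :
    (∑ n : Fin N, C (p.coeff n) * X ^ (n : ℕ)) = p := by
  ext k
  rw [finsetSum_coeff]
  simp only [coeff_C_mul_X_pow]
  by_cases hk : k < N
  · rw [Finset.sum_eq_single ⟨k, hk⟩]
    · simp
    · intro b _ hb
      rw [if_neg]
      exact fun h => hb (Fin.ext (by simp only; omega))
    · simp
  · push Not at hk
    rw [Finset.sum_eq_zero]
    · exact (coeff_eq_zero_of_natDegree_lt (by omega)).symm
    · intro n _
      rw [if_neg]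
      have := n.is_lt; omega

/-- **(A) Orthogonality.**  In a block-Toeplitz slot configuration `T b *ᵥ E c = [b = c] • f`
(`T b` Toeplitz inside every column block of the labelling `blk`, every block lying below its
offset `o`), a simultaneous syzygy `P` of the shifted reversed block polynomials of the frame with
`deg P_c ≤ μ` is orthogonal, together with all its shifts, to the target: the coefficients of
`P_b · φ` vanish in degrees `[μ, N)`, where `φ = ∑_n f n · X^(N-1-n)` is the reversed target
polynomial.  (Pair the shifted syzygy `X^(N-1-K) P`, read as coefficient vectors, with the slot
equations via `hclR_blk_pair_eq_zero`.) -/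
theorem hclR_blk_orth :
    ∀ (N B R : ℕ) (blk : Fin N → Fin B) (o : Fin B → ℕ), (∀ m : Fin N, (m : ℕ) < o (blk m)) →
    ∀ (T : Fin R → Matrix (Fin N) (Fin N) ℂ),
      (∀ b, ∀ i j i' j' : Fin N, blk j = blk j' → (i : ℕ) + j' = i' + j → T b i j = T b i' j') →
    ∀ (E : Fin R → Fin N → ℂ) (f : Fin N → ℂ), (∀ b c, T b *ᵥ E c = if b = c then f else 0) →
    ∀ (P : Fin R → Polynomial ℂ) (μ : ℕ),
      (∀ v : Fin B, ∑ c, P c * (∑ m : Fin N, if blk m = v then Polynomial.C (E c m) * Polynomial.X ^ (o v - 1 - (m : ℕ)) else 0) = 0) →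
      (∀ c, (P c).natDegree ≤ μ) →
      ∀ (b : Fin R) (K : ℕ), μ ≤ K → K < N →
        (P b * (∑ n : Fin N, Polynomial.C (f n) * Polynomial.X ^ (N - 1 - (n : ℕ)))).coeff K = 0 := by
  intro N B R blk o ho T hT E f hcorner P μ hP hdeg b K hμK hKN
  -- adapted from step (A) of `hclR_toeplitz_three_slot` (HiddenCornerLemmaRToeplitzThreeSlot)
  set i := N - 1 - K with hi
  have hdeg' : ∀ c, (X ^ i * P c).natDegree < N := by
    intro c
    calc (X ^ i * P c).natDegree ≤ (X ^ i : ℂ[X]).natDegree + (P c).natDegree := natDegree_mul_le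
      _ ≤ i + μ := by rw [natDegree_X_pow]; exact Nat.add_le_add_left (hdeg c) _
      _ < N := by omega
  set Λ : Fin R → Fin N → ℂ := fun c n => (X ^ i * P c).coeff n with hΛ
  have hΛ' : ∀ c, (∑ n : Fin N, C (Λ c n) * X ^ (n : ℕ)) = X ^ i * P c := fun c =>
    hclR_blk_sum_C_coeff _ (hdeg' c)
  have hsyz' : ∀ v : Fin B, ∑ c, (∑ n : Fin N, C (Λ c n) * X ^ (n : ℕ)) *
      (∑ m : Fin N, if blk m = v then C (E c m) * X ^ (o v - 1 - (m : ℕ)) else 0) = 0 := by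
    intro v
    calc _ = ∑ c, X ^ i * P c *
          (∑ m : Fin N, if blk m = v then C (E c m) * X ^ (o v - 1 - (m : ℕ)) else 0) :=
          Finset.sum_congr rfl fun c _ => by rw [hΛ' c]
      _ = X ^ i * ∑ c, P c *
          (∑ m : Fin N, if blk m = v then C (E c m) * X ^ (o v - 1 - (m : ℕ)) else 0) := by
          rw [Finset.mul_sum]; exact Finset.sum_congr rfl fun c _ => by ring
      _ = 0 := by rw [hP v, mul_zero]
  have key : ∑ c, Λ c ⬝ᵥ (T b *ᵥ E c) = 0 :=
    hclR_blk_pair_eq_zero blk o ho (T b) (hT b) Λ E hsyz'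
  have key2 : Λ b ⬝ᵥ f = 0 := by
    rw [← key, Finset.sum_eq_single b]
    · rw [hcorner b b, if_pos rfl]
    · intro c _ hcb
      rw [hcorner b c, if_neg (Ne.symm hcb), dotProduct_zero]
    · simp
  rw [dotProduct] at key2
  have e : (P b * (∑ n : Fin N, C (f n) * X ^ (N - 1 - (n : ℕ)))).coeff K = ∑ n : Fin N, Λ b n * f n := by
    simp only [hΛ]
    rw [Finset.mul_sum, finsetSum_coeff]
    refine Finset.sum_congr rfl fun n _ => ?_
    rw [← mul_assoc, coeff_mul_X_pow', coeff_mul_C, coeff_X_pow_mul']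
    have := n.is_lt
    by_cases h : i ≤ (n : ℕ)
    · rw [if_pos h, if_pos (show N - 1 - (n : ℕ) ≤ K by omega)]
      have e' : K - (N - 1 - (n : ℕ)) = (n : ℕ) - i := by omega
      rw [e']
    · rw [if_neg h, if_neg (show ¬ (N - 1 - (n : ℕ) ≤ K) by omega), zero_mul]
  rw [e]
  exact key2

end Summit.MatrixMultiplication.MatrixMultiplication.Theorems
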